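import Mathlib.Analysis.SpecialFunctions.Complex.LogDeriv
import Mathlib.Analysis.SpecialFunctions.Complex.Arg
import Mathlib.Analysis.InnerProductSpace.PiL2
import HarnessLib

/-!
# A local smooth azimuth on `ℝ³` off the axis

Support file (all results proved; the definitions are explicit, no named facts). Spherical /
cylindrical coordinates on `ℝ³` have no GLOBAL smooth azimuth `φ` with
`(cos φ, sin φ) = (y₁, y₂)/√(y₁² + y₂²)`, but about every point `x` off the axis `{y₁ = y₂ = 0}`
there is a LOCAL one: with the horizontal complex coordinate `z(y) = y₁ + i y₂` and the unit
complex number `c = z(x)/|z(x)|`,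

  `localAzimuth x y = Im log(c̄ z(y)) + arg c`

(`Complex.log` on the slit plane, where `c̄ z(y)` lies for `y` near `x` since `c̄ z(x) = |z(x)| > 0`).
We prove that near `x` it is `C^∞` (`contDiffAt_localAzimuth`), that it IS an azimuth,
`cos (localAzimuth x y) = y₁/|z(y)|`, `sin (localAzimuth x y) = y₂/|z(y)|`
(`cos_localAzimuth`, `sin_localAzimuth`, for every `y` with `c̄ z(y)` in the slit plane, in
particular eventually near `x`), and that its differential at `x` is the classical
`dφ = (x₁ dy₂ − x₂ dy₁)/(x₁² + x₂²)` (`hasFDerivAt_localAzimuth`, `dPhiCLM`). Indices are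
`0, 1, 2` for `y₁, y₂, y₃` (`EuclideanSpace ℝ (Fin 3)`).

Used for differentiating maps given in spherical coordinates at off-axis points (the
Boyer–Lindquist leaf of Kerr in quasi-isotropic Cartesian coordinates,
`Literature/Geometry/Lorentzian/KerrBoyerLindquist*.lean`). Elementary complex analysis:
Ahlfors, *Complex Analysis*, Ch. 2, §1.2 and Ch. 3, §3.4 (branches of `log` and `arg`).
-/

noncomputable section

open Complex Filter Set
open scoped Topology ContDiff ComplexConjugate

namespace Literature.Analysis.Calculus

/-! ### The horizontal complex coordinate -/

/-- The horizontal complex coordinate `z(y) = y₁ + i y₂` of a point of `ℝ³`, as a real-linear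
continuous map `ℝ³ →L[ℝ] ℂ`. [folklore] -/
def zCLM : EuclideanSpace ℝ (Fin 3) →L[ℝ] ℂ :=
  (equivRealProdCLM.symm : ℝ × ℝ →L[ℝ] ℂ).comp
    ((EuclideanSpace.proj (𝕜 := ℝ) (0 : Fin 3)).prod (EuclideanSpace.proj (𝕜 := ℝ) (1 : Fin 3)))

/-- `z(y) = y₁ + y₂ i`. [folklore] -/
theorem zCLM_apply (y : EuclideanSpace ℝ (Fin 3)) : zCLM y = (y 0 : ℂ) + (y 1 : ℂ) * I := by
  simp [zCLM, equivRealProdCLM_symm_apply]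

/-- `Re z(y) = y₁`. [folklore] -/
@[simp] theorem zCLM_re (y : EuclideanSpace ℝ (Fin 3)) : (zCLM y).re = y 0 := by
  rw [zCLM_apply]; simp

/-- `Im z(y) = y₂`. [folklore] -/
@[simp] theorem zCLM_im (y : EuclideanSpace ℝ (Fin 3)) : (zCLM y).im = y 1 := by
  rw [zCLM_apply]; simp

/-- `|z(y)|² = y₁² + y₂²` (`normSq`). [folklore] -/
theorem normSq_zCLM (y : EuclideanSpace ℝ (Fin 3)) : normSq (zCLM y) = y 0 ^ 2 + y 1 ^ 2 := by
  rw [normSq_apply, zCLM_re, zCLM_im]; ring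

/-- `|z(y)| = √(y₁² + y₂²)`. [folklore] -/
theorem norm_zCLM (y : EuclideanSpace ℝ (Fin 3)) : ‖zCLM y‖ = Real.sqrt (y 0 ^ 2 + y 1 ^ 2) := by
  rw [Complex.norm_def, normSq_zCLM]

/-- Off the axis `z(y) ≠ 0`. [folklore] -/
theorem zCLM_ne_zero {y : EuclideanSpace ℝ (Fin 3)} (hy : y 0 ≠ 0 ∨ y 1 ≠ 0) : zCLM y ≠ 0 := by
  intro h0
  have h1 : (zCLM y).re = 0 := by rw [h0]; rfl
  have h2 : (zCLM y).im = 0 := by rw [h0]; rfl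
  rw [zCLM_re] at h1
  rw [zCLM_im] at h2
  rcases hy with h | h
  · exact h h1
  · exact h h2

/-! ### The azimuth differential -/

/-- **The classical azimuth differential** `dφ_x = (x₁ dy₂ − x₂ dy₁)/(x₁² + x₂²)` as a continuous
linear form on `ℝ³`. [folklore] -/
def dPhiCLM (x : EuclideanSpace ℝ (Fin 3)) : EuclideanSpace ℝ (Fin 3) →L[ℝ] ℝ :=
  (x 0 ^ 2 + x 1 ^ 2)⁻¹ •
    (x 0 • (EuclideanSpace.proj (𝕜 := ℝ) (1 : Fin 3) : EuclideanSpace ℝ (Fin 3) →L[ℝ] ℝ) -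
      x 1 • (EuclideanSpace.proj (𝕜 := ℝ) (0 : Fin 3) : EuclideanSpace ℝ (Fin 3) →L[ℝ] ℝ))

/-- `dφ_x(v) = (x₁ v₂ − x₂ v₁)/(x₁² + x₂²)`. [folklore] -/
@[simp] theorem dPhiCLM_apply (x v : EuclideanSpace ℝ (Fin 3)) :
    dPhiCLM x v = (x 0 * v 1 - x 1 * v 0) / (x 0 ^ 2 + x 1 ^ 2) := by
  simp [dPhiCLM, div_eq_inv_mul]

/-! ### The local azimuth -/

/-- The unit complex number `c(x) = z(x)/|z(x)|` in the direction of the horizontal part of `x`.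
[folklore] -/
def unitDir (x : EuclideanSpace ℝ (Fin 3)) : ℂ :=
  zCLM x / (‖zCLM x‖ : ℂ)

/-- `|c(x)| = 1` off the axis. [folklore] -/
theorem norm_unitDir {x : EuclideanSpace ℝ (Fin 3)} (hx : x 0 ≠ 0 ∨ x 1 ≠ 0) : ‖unitDir x‖ = 1 := by
  have h0 : ‖zCLM x‖ ≠ 0 := norm_ne_zero_iff.2 (zCLM_ne_zero hx)
  rw [unitDir, norm_div, Complex.norm_real, Real.norm_of_nonneg (norm_nonneg _), div_self h0]

/-- `c(x) ≠ 0` off the axis. [folklore] -/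
theorem unitDir_ne_zero {x : EuclideanSpace ℝ (Fin 3)} (hx : x 0 ≠ 0 ∨ x 1 ≠ 0) : unitDir x ≠ 0 := by
  rw [← norm_pos_iff, norm_unitDir hx]; exact one_pos

/-- **`c̄ z(x) = |z(x)|`**, a positive real number: the rotated horizontal coordinate of the base
point lies on the positive real axis, inside the slit plane. [folklore] -/
theorem conj_unitDir_mul_zCLM_self {x : EuclideanSpace ℝ (Fin 3)} (hx : x 0 ≠ 0 ∨ x 1 ≠ 0) :
    conj (unitDir x) * zCLM x = (‖zCLM x‖ : ℂ) := by
  have h0 : (‖zCLM x‖ : ℂ) ≠ 0 := ofReal_ne_zero.2 (norm_ne_zero_iff.2 (zCLM_ne_zero hx))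
  rw [unitDir, map_div₀, Complex.conj_ofReal, div_mul_eq_mul_div, div_eq_iff h0,
    mul_comm (conj (zCLM x)), mul_conj, normSq_eq_norm_sq]
  push_cast
  ring

/-- `c̄(x) z(y) · c(x) = z(y)` (`|c| = 1`). [folklore] -/
theorem conj_unitDir_mul_mul_unitDir {x : EuclideanSpace ℝ (Fin 3)} (hx : x 0 ≠ 0 ∨ x 1 ≠ 0) (y : EuclideanSpace ℝ (Fin 3)) :
    conj (unitDir x) * zCLM y * unitDir x = zCLM y := by
  have h : unitDir x * conj (unitDir x) = 1 := by
    rw [mul_conj, normSq_eq_norm_sq, norm_unitDir hx]; norm_num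
  calc conj (unitDir x) * zCLM y * unitDir x = zCLM y * (unitDir x * conj (unitDir x)) := by ring
    _ = zCLM y := by rw [h, mul_one]

/-- **The local azimuth about `x`**: `Φ_x(y) = Im log(c̄(x) z(y)) + arg c(x)`, `c(x) = z(x)/|z(x)|`
(the principal branch of `arg(c̄ z) + arg c = arg z (mod 2π)`, centred at the direction of `x`).
Ahlfors, Ch. 3, §3.4. [folklore] -/
def localAzimuth (x : EuclideanSpace ℝ (Fin 3)) (y : EuclideanSpace ℝ (Fin 3)) : ℝ :=
  (Complex.log (conj (unitDir x) * zCLM y)).im + arg (unitDir x)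

/-- Near `x` (off the axis) the rotated horizontal coordinate `c̄ z(y)` lies in the slit plane.
[folklore] -/
theorem eventually_mem_slitPlane {x : EuclideanSpace ℝ (Fin 3)} (hx : x 0 ≠ 0 ∨ x 1 ≠ 0) :
    ∀ᶠ y in 𝓝 x, conj (unitDir x) * zCLM y ∈ slitPlane := by
  have hcont : Continuous fun y : EuclideanSpace ℝ (Fin 3) ↦ conj (unitDir x) * zCLM y := continuous_const.mul zCLM.continuous
  have hmem : conj (unitDir x) * zCLM x ∈ slitPlane := by
    rw [conj_unitDir_mul_zCLM_self hx]
    exact ofReal_mem_slitPlane.2 (norm_pos_iff.2 (zCLM_ne_zero hx))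
  exact hcont.continuousAt.eventually (isOpen_slitPlane.mem_nhds hmem)

/-- **The local azimuth is `C^∞`** at every point `y` where `c̄ z(y)` is in the slit plane (in
particular near `x`). [folklore] -/
theorem contDiffAt_localAzimuth_of_mem {x y : EuclideanSpace ℝ (Fin 3)} (hy : conj (unitDir x) * zCLM y ∈ slitPlane)
    {n : WithTop ℕ∞} : ContDiffAt ℝ n (localAzimuth x) y := by
  have h1 : ContDiffAt ℝ n (fun y : EuclideanSpace ℝ (Fin 3) ↦ conj (unitDir x) * zCLM y) y :=
    contDiffAt_const.mul zCLM.contDiff.contDiffAt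
  have h2 : ContDiffAt ℝ n Complex.log (conj (unitDir x) * zCLM y) :=
    (Complex.contDiffAt_log hy).restrict_scalars ℝ
  have h3 := h2.comp y h1
  unfold localAzimuth
  exact (imCLM.contDiff.contDiffAt.comp y h3).add contDiffAt_const

/-- The local azimuth is `C^∞` at its base point (and nearby). [folklore] -/
theorem contDiffAt_localAzimuth {x : EuclideanSpace ℝ (Fin 3)} (hx : x 0 ≠ 0 ∨ x 1 ≠ 0) {n : WithTop ℕ∞} :
    ContDiffAt ℝ n (localAzimuth x) x :=
  contDiffAt_localAzimuth_of_mem (by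
    rw [conj_unitDir_mul_zCLM_self hx]
    exact ofReal_mem_slitPlane.2 (norm_pos_iff.2 (zCLM_ne_zero hx)))

/-- Eventually near `x` the local azimuth is `C^∞`. [folklore] -/
theorem eventually_contDiffAt_localAzimuth {x : EuclideanSpace ℝ (Fin 3)} (hx : x 0 ≠ 0 ∨ x 1 ≠ 0) {n : WithTop ℕ∞} :
    ∀ᶠ y in 𝓝 x, ContDiffAt ℝ n (localAzimuth x) y :=
  (eventually_mem_slitPlane hx).mono fun _ hy ↦ contDiffAt_localAzimuth_of_mem hy

/-- **The local azimuth is an azimuth: cosine.** For `y` off the axis,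
`cos Φ_x(y) = y₁/|z(y)|` (`cos(arg w + arg c) = Re(w c)/(|w||c|)` and `c̄ z c = z`).
Ahlfors, Ch. 2, §1.2. [folklore] -/
theorem cos_localAzimuth {x y : EuclideanSpace ℝ (Fin 3)} (hx : x 0 ≠ 0 ∨ x 1 ≠ 0) (hy : y 0 ≠ 0 ∨ y 1 ≠ 0) :
    Real.cos (localAzimuth x y) = y 0 / ‖zCLM y‖ := by
  set w : ℂ := conj (unitDir x) * zCLM y with hw
  have hc0 : unitDir x ≠ 0 := unitDir_ne_zero hx
  have hz0 : zCLM y ≠ 0 := zCLM_ne_zero hy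
  have hw0 : w ≠ 0 := mul_ne_zero ((map_ne_zero _).2 hc0) hz0
  have hwn : ‖w‖ = ‖zCLM y‖ := by
    rw [hw, norm_mul, Complex.norm_conj, norm_unitDir hx, one_mul]
  have hprod : w * unitDir x = zCLM y := conj_unitDir_mul_mul_unitDir hx y
  rw [localAzimuth, ← hw, log_im, Real.cos_add, cos_arg hw0, sin_arg, cos_arg hc0, sin_arg,
    norm_unitDir hx, div_one, div_one, hwn]
  have key : w.re * (unitDir x).re - w.im * (unitDir x).im = y 0 := by
    have h := mul_re w (unitDir x)
    rw [hprod, zCLM_re] at h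
    exact h.symm
  rw [div_mul_eq_mul_div, div_mul_eq_mul_div, ← sub_div, key]

/-- **The local azimuth is an azimuth: sine.** For `y` off the axis, `sin Φ_x(y) = y₂/|z(y)|`.
Ahlfors, Ch. 2, §1.2. [folklore] -/
theorem sin_localAzimuth {x y : EuclideanSpace ℝ (Fin 3)} (hx : x 0 ≠ 0 ∨ x 1 ≠ 0) (hy : y 0 ≠ 0 ∨ y 1 ≠ 0) :
    Real.sin (localAzimuth x y) = y 1 / ‖zCLM y‖ := by
  set w : ℂ := conj (unitDir x) * zCLM y with hw
  have hc0 : unitDir x ≠ 0 := unitDir_ne_zero hx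
  have hz0 : zCLM y ≠ 0 := zCLM_ne_zero hy
  have hw0 : w ≠ 0 := mul_ne_zero ((map_ne_zero _).2 hc0) hz0
  have hwn : ‖w‖ = ‖zCLM y‖ := by
    rw [hw, norm_mul, Complex.norm_conj, norm_unitDir hx, one_mul]
  have hprod : w * unitDir x = zCLM y := conj_unitDir_mul_mul_unitDir hx y
  rw [localAzimuth, ← hw, log_im, Real.sin_add, cos_arg hw0, sin_arg, cos_arg hc0, sin_arg,
    norm_unitDir hx, div_one, div_one, hwn]
  have key : w.re * (unitDir x).im + w.im * (unitDir x).re = y 1 := by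
    have h := mul_im w (unitDir x)
    rw [hprod, zCLM_im] at h
    exact h.symm
  rw [div_mul_eq_mul_div, div_mul_eq_mul_div, ← add_div, add_comm, key]

/-- **The differential of the local azimuth at its base point is the classical azimuth form**:
`dΦ_x = Im(z(x)⁻¹ dz) = (x₁ dy₂ − x₂ dy₁)/(x₁² + x₂²)` (chain rule with `d log w = w⁻¹ dw` on
the slit plane; the constant `c̄` cancels). Ahlfors, Ch. 3, §3.4. [folklore] -/
theorem hasFDerivAt_localAzimuth {x : EuclideanSpace ℝ (Fin 3)} (hx : x 0 ≠ 0 ∨ x 1 ≠ 0) :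
    HasFDerivAt (localAzimuth x) (dPhiCLM x) x := by
  set k : ℂ := conj (unitDir x) with hk
  have hk0 : k ≠ 0 := (map_ne_zero _).2 (unitDir_ne_zero hx)
  have hz0 : zCLM x ≠ 0 := zCLM_ne_zero hx
  have hmem : k * zCLM x ∈ slitPlane := by
    rw [hk, conj_unitDir_mul_zCLM_self hx]
    exact ofReal_mem_slitPlane.2 (norm_pos_iff.2 hz0)
  -- `y ↦ k z(y)` is real-linear
  have h1 : HasFDerivAt (fun y : EuclideanSpace ℝ (Fin 3) ↦ k * zCLM y) (k • zCLM) x := zCLM.hasFDerivAt.const_mul k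
  have h2 : HasFDerivAt Complex.log ((k * zCLM x)⁻¹ • (1 : ℂ →L[ℝ] ℂ)) (k * zCLM x) :=
    (hasStrictFDerivAt_log_real hmem).hasFDerivAt
  have h3 := h2.comp x h1
  have h4 := (imCLM.hasFDerivAt.comp x h3).add_const (arg (unitDir x))
  unfold localAzimuth
  refine h4.congr_fderiv ?_
  ext v
  show ((k * zCLM x)⁻¹ * (k * zCLM v)).im = dPhiCLM x v
  rw [dPhiCLM_apply]
  -- `Im((k z_x)⁻¹ (k z_v)) = Im(z_x⁻¹ z_v) = (x₁ v₂ − x₂ v₁)/(x₁² + x₂²)`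
  have hcancel : (k * zCLM x)⁻¹ * (k * zCLM v) = (zCLM x)⁻¹ * zCLM v := by
    field_simp
  rw [hcancel, inv_def, mul_im]
  simp only [mul_re, mul_im, conj_re, conj_im, ofReal_re, ofReal_im, zCLM_re, zCLM_im,
    normSq_zCLM, mul_zero, sub_zero]
  field_simp
  ring

end Literature.Analysis.Calculus

end
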